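import Literature.MathematicalPhysics.QuantumLattice.HubbardModel
import Literature.MathematicalPhysics.QuantumLattice.HubbardRectangularTorus
import Literature.MathematicalPhysics.QuantumLattice.HubbardTorus2DEnergyDensity
import Literature.MathematicalPhysics.QuantumLattice.AndersonHeisenbergStarBound
import HarnessLib
import HarnessLib.Audit

/-!
# Many-body bootstrap — Bounds, engineer-2 family (`E2`): certified Hubbard / Heisenberg ground-state energy bounds
# by exact diagonalisation, Falicov–Kimball/Langer–Mattis splitting, Anderson clusters, Hartree–Fock and product states

Cell pub-mbboot (bundle `papers/HubbardSuperconductivity/manybody-bootstrap/`, HOME `run/shared/lean/pub/pub-mbboot/`), unit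
pub-mbboot-sdp2 ("engineer 2", E2). HONEST FRAMING: certified numerical bounds on a lattice model; not superconductivity, not a
phase diagram. All at `t = 1`.

This directory (`…/ManyBodyBootstrap/Bounds/E2/`) is the in-tree form of the cell's staged module `HOME/lean/HubbardCertifiedBoundsE2.lean`
(generated by E2's `make_lean.py` from the certificate files in `HOME/pub-mbboot-sdp2/certs/`, format `mbboot-e2-cert-v1`; each
row names its certificate file, sha256, producing `kit compute` job and the deterministic VERIFICATION job — `verify_e2.py`, report
`verification/VERIFY_<job>.json`; arguments in `HOME/pub-mbboot-sdp2/PROOFS.md`), split into parts of ≤ 400 lines by the cell's literature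
seat (tool `file_parts_g19.py`; unit→part table in HOME/PLACEMENT.md):

* `E2/Defs` (this file): the helper shapes `E0Lower a b t U N q := q ≤ groundEnergyAt (fermionRectTorusGraph a b) t U N`, `E0Upper`,
  `DensityLower t U n q := q ≤ energyDensity2D t U n`, `DensityUpper`, the Heisenberg-ring enclosure shape `HeisRingE0`, and the
  torus-FAMILY upper-bound shapes `HeisTorusFamilyUpper` / `HeisRingFamilyUpper` / `HubRingFamilyUpper` (every torus / ring of side
  divisible by `P` and `≥ L₀`; the tree's way of stating a thermodynamic-limit upper bound where no energy-density constant exists);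
* `E2/EDRows`: kind `ed-torus` — two-sided exact-arithmetic ED enclosures of `E₀(N)` on the `2×2`, `3×2`, `4×2` tori and the 6-, 8-site
  rings (per `(N↑,N↓)` sector an exact integer sparse matrix; UPPER = exact integer Rayleigh quotient of a rounded eigenvector, LOWER =
  dyadic shift with an exact integer residual of a rounded Cholesky factor, Gershgorin on the exact residual);
* `E2/FourByFourAndTLRows`: kinds `fk-torus` (Falicov–Kimball/Langer–Mattis splitting lower bounds on the `4×4` torus, exact inertia),
  `lanczos-upper-torus` (exact Rayleigh quotients of quantised Lanczos vectors), `fk-tl` (Kennedy–Lieb + Langer–Mattis + certified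
  quadrature, thermodynamic limit), `hf-tl-upper` (AF Hartree–Fock Slater determinants + certified quadrature), `hub-tl-luc-upper`
  (plaquette local-unitary-dressed AF Hartree–Fock states; exact rational Cayley unitaries + ball arithmetic), `anderson-cluster`
  (translate-cover lower bounds for `energyDensity2D`);
* `E2/HeisenbergRows`: Heisenberg rings (two-sided ED enclosures), the `4×4` Heisenberg torus, `6×4` / `6×6` matrix-product-state
  Rayleigh uppers, and square-lattice thermodynamic-limit uppers from open-cluster product states (torus families);
* `E2/ChainRows`: Heisenberg and Hubbard CHAIN thermodynamic-limit uppers from open-segment product / matrix-product states (ring families).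

The soundness step of every kind (variational principle; Anderson / Langer–Mattis / Kennedy–Lieb cluster bounds; passage to the
thermodynamic limit) is a PROVED tree theorem (`Literature/MathematicalPhysics/QuantumLattice/{HubbardRectangularTorus, HubbardTorus2DEnergyDensity,
AndersonHeisenbergStarBound, HubbardLangerMattis*, HartreeFock*, HeisenbergClusterProductUpperBound, …}.lean`); the finite exact-arithmetic
evaluation is the certificate. CONVENTIONS (as in `HubbardLadder/Bounds` and `ManyBodyBootstrap/Bounds`): every certificate-backed statement
is a CLAIM NODE `@[conjecture] def <row> : Prop` — an open obligation node closable in-kernel from the certificate's exact data, NOT a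
vendored fact, NOT a citation; its docstring ends with `[computation: <format>, exact ℚ]`. Nothing here is proved in Lean and no
statement here is cited anywhere as a fact. Declarations are byte-identical to the staged module except for the namespace
(`Summit.HubbardSuperconductivity.Bounds.E2` → `Summit.HubbardSuperconductivity.ManyBodyBootstrap.Bounds.E2`), the attribute and the tag.
Landed tree files are append-only: later E2 rows arrive as further parts.
-/

noncomputable section

namespace Summit.HubbardSuperconductivity.ManyBodyBootstrap.Bounds.E2

open Literature.MathematicalPhysics.QuantumLattice Literature.MathematicalPhysics.QuantumLattice.ThermodynamicLimit
open Literature.Probability.LatticeModels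

/-- `q ≤ E₀(N)` on the `a×b` torus. -/
def E0Lower (a b : ℕ) (t U : ℚ) (N : ℕ) (q : ℚ) : Prop :=
  (q : ℝ) ≤ groundEnergyAt (fermionRectTorusGraph a b) (t : ℝ) (U : ℝ) N

/-- `E₀(N) ≤ q` on the `a×b` torus. -/
def E0Upper (a b : ℕ) (t U : ℚ) (N : ℕ) (q : ℚ) : Prop :=
  groundEnergyAt (fermionRectTorusGraph a b) (t : ℝ) (U : ℝ) N ≤ (q : ℝ)

/-- `q ≤ e(t,U,n)` for the thermodynamic-limit density `energyDensity2D`. -/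
def DensityLower (t U n q : ℚ) : Prop :=
  (q : ℝ) ≤ energyDensity2D (t : ℝ) (U : ℝ) (n : ℝ)

/-- `e(t,U,n) ≤ q`. -/
def DensityUpper (t U n q : ℚ) : Prop :=
  energyDensity2D (t : ℝ) (U : ℝ) (n : ℝ) ≤ (q : ℝ)

open Literature.Probability.LatticeModels in
/-- two-sided enclosure of the Heisenberg ring ground energy. [folklore] -/
def HeisRingE0 (Lr : ℕ) [NeZero Lr] (lo up : ℚ) : Prop :=
  ((lo : ℝ) ≤ (heisenbergHamiltonian 1 (torusGraph 1 Lr) 1).groundEnergy) ∧ ((heisenbergHamiltonian 1 (torusGraph 1 Lr) 1).groundEnergy ≤ (up : ℝ))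

/-- (gen 2) TL upper bound in tree-only form: `E₀(Heisenberg AF, L×L torus) ≤ q·L²` for every `L ≥ L₀` divisible by `P` (product of open-cluster states over the tiling of the torus by translates of the a×b cluster, P = lcm(a,b), L₀ = 2·max(a,b); PROOFS.md P5). With the lit-seat's `heisenbergEnergyDensity 1 2 1 = lim E₀(torus L)/L²` (HeisenbergEnergyDensity.lean, `tendsto_heisenbergEnergyDensity`) this gives `e ≤ q`. [folklore] -/
def HeisTorusFamilyUpper (P L₀ : ℕ) (q : ℚ) : Prop :=
  ∀ (L : ℕ) [NeZero L], P ∣ L → L₀ ≤ L → (heisenbergHamiltonian 1 (torusGraph 2 L) 1).groundEnergy ≤ (q : ℝ) * (L : ℝ) ^ 2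

/-- `E₀(Heisenberg AF ring of L sites) ≤ q·L` for every `L ≥ L₀` with `P ∣ L` (product of open-segment states; PROOFS.md P5). [folklore] -/
def HeisRingFamilyUpper (P L₀ : ℕ) (q : ℚ) : Prop :=
  ∀ (L : ℕ) [NeZero L], P ∣ L → L₀ ≤ L → (heisenbergHamiltonian 1 (torusGraph 1 L) 1).groundEnergy ≤ (q : ℝ) * (L : ℝ)

/-- `E₀(Hubbard ring of L sites, t = 1, interaction U, N = L electrons) ≤ q·L` for every `L ≥ L₀` with `P ∣ L` (product of fixed-N open-segment states; PROOFS.md P5). [folklore] -/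
def HubRingFamilyUpper (P L₀ : ℕ) (U q : ℚ) : Prop :=
  ∀ (L : ℕ) [NeZero L], P ∣ L → L₀ ≤ L → groundEnergyAt (fermionTorusGraph 1 L) 1 (U : ℝ) L ≤ (q : ℝ) * (L : ℝ)

end Summit.HubbardSuperconductivity.ManyBodyBootstrap.Bounds.E2

end
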